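/-
Copyright (c) 2026 the pub-hodgecm-mathlib formalisation cell (harness21).  Prover seat hodgecm-mathlib-F0P3-p02 (g16), 2026-09-01.  Road «S3-ram» seeding wave (LEAD F0P3a-plan (g12) T11-41∕T11-54∕T11-57;
owner F0P3a-p06 (g15)), row «(L)-ram» file L5-D: the JUNCTION «two-layer (U)-ram head ⊕ split `N ∩ K₃`-average = the `hN` socket of ★ p846921» for a `v`-level-one `K`-class piece.
-/
import Literature.NumberTheory.Rogawski1990.LevelOnePieceAverageSplitRamified              -- ★ FILE L5-C2 (this seat): `integral_comp_symm_eq_of_levelOne_split_ramified`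
import Literature.NumberTheory.Rogawski1990.LevelOnePieceTwoLayerStrataConstancyRamified    -- ★ (F0P2-p01 (g15)) the TWO-LAYER (U)-ram HEAD `exists_twoLayerStrataValues_of_levelOne_ramified_of_not_isSquare`
import HarnessLib

/-!
# The `hN` socket of ★ p846921 DISCHARGED for every `v`-level-one `K`-class piece at a tame-ramified place (junction of the (U)-ram head and the (L)-ram average)
(Rogawski (1990) §4.9 Prop. 4.9.1 pp. 54–56, §12.2 p. 173)

Topic `NumberTheory/Rogawski1990`; namespace `Literature.NumberTheory.Rogawski1990`.  KERNEL mathematics only: one theorem, no definition, no named fact, no instance, no notation,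
no `sorry`.  Cell `pub/hodgecm-mathlib`, crux H413 = `stmt-HodgeConjecture-24833`; road «S3-ram» seeding wave (LEAD F0P3a-plan (g12); owner F0P3a-p06 (g15)), row **«(L)-ram», FILE L5-D**
(seat F0P3-p02 (g16)).  CONSUMER: the (e3) LEVI clause of END F0P3a-p03 (g16)'s fold v6 `stub_levelOneRowsRam` :118 through F0P3a-p01 (g15)'s ★ p846921
`finsum_delta_mul_classOrbitalIntegral_eq_of_levi_ramified_levelOne_of_delta_eq`, whose socket `hN` asks for ONE scalar `X` with `∫_N g(ψ⁻¹ n) dμ_N = μ_N(N ∩ K₃)·X` for EVERY level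
frame `ψ` with integral matrix reading and EVERY Haar `μ_N`.  HONEST LABEL: HC_CM is proved only modulo the 2 remaining named inputs (hLiu418 24832, h413 24833) until rung 0 closes;
«S3-ram» is Literature seeding; this file discharges no named fact.

THE MATHEMATICS.  Binders = the piece group of the fold's :118 VERBATIM (`hH' w hw he hH'w hH'i h2`, block `ϖ hϖ hσϖ`, frame `A hA hframe`, piece `g hgK hginv hg1`).  The two-layer head
★ `exists_twoLayerStrataValues_of_levelOne_ramified_of_not_isSquare` (F0P2-p01 (g15), over ★ p846992 F0P3a-p05 (g16) and ★ p846963) gives the five strata values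
`c 2 | c′ 0, c′ 2 | c₁ 1, c₁ ε` of `g` (`ε` any non-square residue, ★ `FiniteField.exists_nonsquare` at odd residue characteristic); ★ FILE L5-C2
`integral_comp_symm_eq_of_levelOne_split_ramified` turns them into the `N ∩ K₃`-average through ANY frame.  Hence
**`∃ X, ∀ ψ T μ_N, ∫_N g(ψ⁻¹ n) dμ_N = μ_N(N ∩ K₃)·X`**, namely `X = c 2·(1 − q⁻¹) + q⁻¹·(c′ 2·(1 − q⁻¹) + ½(c₁ 1 + c₁ ε)·q⁻¹(1 − q⁻¹) + c′ 0·q⁻²)` (`exists_integral_comp_symm_eq_mul_of_levelOne_ramified`;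
the `∀`-body is ★ p846921's `hN` TEXTUALLY, so the integrator writes `obtain ⟨X, hN⟩ := …` and passes `hN`).

## References
* [Rogawski1990] J. D. Rogawski, *Automorphic Representations of Unitary Groups in Three Variables*, Ann. of Math. Stud. 123 (1990), §4.9 Prop. 4.9.1 pp. 54–56; §12.2 p. 173.
* [Kottwitz1986] R. E. Kottwitz, *Base change for unit elements of Hecke algebras*, Compositio Math. 60 (1986), §3 (congruence filtration).
-/

set_option autoImplicit false

noncomputable section

open MeasureTheory Measure Set Filter Topology NumberField IsDedekindDomain Matrix ValuativeRel
open scoped ENNReal NNReal Matrix MatrixGroups ValuativeRel WithZero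

namespace Literature.NumberTheory.Rogawski1990

open Literature.NumberTheory.Automorphic Literature.NumberTheory.Automorphic.UnitaryGroup Literature.NumberTheory.Automorphic.IntegralReduction
open Literature.NumberTheory.GaloisRepresentations

set_option maxHeartbeats 1600000 in
-- budget only: one statement-heavy declaration (the fold's :118 tokens and ★ p846921's socket); no search tactic runs long here.
/-- **THE `hN` SOCKET OF ★ p846921 FOR A `v`-LEVEL-ONE `K`-CLASS PIECE AT A TAME-RAMIFIED PLACE.**  For `g` supported in `K′`, `Ad K′`-invariant and left-invariant under the
`v`-level-one congruence set (fold v6 :118 binders VERBATIM, with the ramified block `ϖ hϖ hσϖ` and the integral antidiagonal frame `A hA hframe` of `H′_w`):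
**`∃ X : ℂ`, for EVERY level frame `ψ : U(H′)_v ≃ U(Φ₃)_v` with integral matrix reading `(ψ x)_w = T x_w T⁻¹` and EVERY Haar measure `μ_N` of `N`,
`∫_N g(ψ⁻¹ n) dμ_N = μ_N(N ∩ K₃)·X`** — the `∀`-body is ★ p846921's `hN` textually; `X = c 2(1 − q⁻¹) + q⁻¹(c′ 2(1 − q⁻¹) + ½(c₁ 1 + c₁ ε)q⁻¹(1 − q⁻¹) + c′ 0·q⁻²)` for the head's values.
[cite: Rogawski1990, §4.9 Prop. 4.9.1 pp. 54–56; §12.2 p. 173] [cite: Kottwitz1986, §3] -/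
theorem exists_integral_comp_symm_eq_mul_of_levelOne_ramified
    (L : Type) [Field L] [NumberField L] [IsCMField L] (H' : Matrix (Fin 3) (Fin 3) L)
    {v : HeightOneSpectrum (𝓞 ↥(maximalRealSubfield L))}
    (hH' : (H'.map (cmConjRingHom L)).transpose = H') (w : PlacesOver L v)
    (hw : IsCMField.complexConj L • w.1 = w.1) (he : v.asIdeal.ramificationIdx' w.1.asIdeal ≠ 1)
    (hH'w : IsUnit (placeForm H' w.1)) (hH'i : hH'w.unit ∈ glInt 3 (w.1.adicCompletion L))
    (h2 : IsUnit (2 : 𝒪[(w.1.adicCompletion L)]))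
    (ϖ : (w.1.adicCompletion L)) (hϖ : Valued.v ϖ = WithZero.exp (-1 : ℤ)) (hσϖ : galAdicCompletionMap (L := L) (IsCMField.complexConj L) hw ϖ = -ϖ)
    (A : GL (Fin 3) (w.1.adicCompletion L)) (hA : A ∈ glInt 3 (w.1.adicCompletion L))
    (hframe : placeForm H' w.1 = (-(placeForm H' w.1).det) • formCongr (galAdicCompletionMap (L := L) (IsCMField.complexConj L) hw) A ((StdForm.antidiagonal 3).over (w.1.adicCompletion L)))
    (g : ((cmDatum L 3 H').Local v) → ℂ)
    (hginv : ∀ u ∈ cmLocalIntegralLevel L 3 H' v, ∀ x, g (u * x * u⁻¹) = g x)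
    (hg1 : ∀ u : ((cmDatum L 3 H').Local v),
      (∀ a b, Valued.v (((toPlace v w (HeckeCharacter.uniformizer ↥(maximalRealSubfield L) v : v.adicCompletion ↥(maximalRealSubfield L))) ^ 1)⁻¹ *
        ((((localNonsplitEquiv (IsCMField.complexConj L) H' (IsCMField.complexConj_ne_one L) w hw u :
            ↥(unitaryGroupOfForm (galAdicCompletionMap (L := L) (IsCMField.complexConj L) hw) (placeForm H' w.1))) : GL (Fin 3) (w.1.adicCompletion L)) :
              Matrix (Fin 3) (Fin 3) (w.1.adicCompletion L)) a b - (1 : Matrix (Fin 3) (Fin 3) (w.1.adicCompletion L)) a b)) ≤ 1) →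
      ∀ x, g (u * x) = g x)
    (hgK : tsupport g ⊆ (cmLocalIntegralLevel L 3 H' v : Set ((cmDatum L 3 H').Local v))) :
    ∃ X : ℂ, ∀ [MeasurableSpace ↥(unitaryGroupOfForm (conjLocal L (IsCMField.complexConj L) v) (cmLocalForm L 3 v))] [BorelSpace ↥(unitaryGroupOfForm (conjLocal L (IsCMField.complexConj L) v) (cmLocalForm L 3 v))]
      (ψ : (cmDatum L 3 H').Local v ≃ₜ* ↥(unitaryGroupOfForm (conjLocal L (IsCMField.complexConj L) v) (cmLocalForm L 3 v)))
      (_hψK : ∀ g : (cmDatum L 3 H').Local v, ψ g ∈ cmLocalIntegralLevel L 3 (Matrix.of fun i j : Fin 3 => if i.val + j.val + 1 = 3 then (1 : L) else 0) v ↔ g ∈ cmLocalIntegralLevel L 3 H' v)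
      (_hψc : ∀ g : (cmDatum L 3 H').Local v, IsConj (g.val : GL (Fin 3) (LocalRing L v)) ((ψ g : ↥(unitaryGroupOfForm (conjLocal L (IsCMField.complexConj L) v) (cmLocalForm L 3 v))) : GL (Fin 3) (LocalRing L v)))
      (T : GL (Fin 3) (w.1.adicCompletion L)) (_hT : T ∈ glInt 3 (w.1.adicCompletion L))
      (_hψT : ∀ g : (cmDatum L 3 H').Local v, localGLPiEquiv L 3 v (((ψ g : ↥(unitaryGroupOfForm (conjLocal L (IsCMField.complexConj L) v) (cmLocalForm L 3 v)))) : GL (Fin 3) (LocalRing L v)) w =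
        T * localGLPiEquiv L 3 v (g.val : GL (Fin 3) (LocalRing L v)) w * T⁻¹)
      (μN : Measure ↥(unipotentU (conjLocal L (IsCMField.complexConj L) v) (cmLocalForm L 3 v))) [μN.IsHaarMeasure],
      ∫ n, g (ψ.symm (n : ↥(unitaryGroupOfForm (conjLocal L (IsCMField.complexConj L) v) (cmLocalForm L 3 v)))) ∂μN =
        (μN.real {n : ↥(unipotentU (conjLocal L (IsCMField.complexConj L) v) (cmLocalForm L 3 v)) |
            (n : ↥(unitaryGroupOfForm (conjLocal L (IsCMField.complexConj L) v) (cmLocalForm L 3 v))) ∈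
              cmLocalIntegralLevel L 3 (Matrix.of fun i j : Fin 3 => if i.val + j.val + 1 = 3 then (1 : L) else 0) v} : ℂ) * X := by
  haveI : Finite (Valued.ResidueField (w.1.adicCompletion L)) := finite_residueField_adicCompletion L w.1
  haveI : Finite 𝓀[(w.1.adicCompletion L)] := finite_residueField_of_compatible (K := w.1.adicCompletion L)
  -- `|2|_w = 1` from `2 ∈ 𝒪_wˣ`, and a non-square residue `ε`
  have h2w : Valued.v (2 : w.1.adicCompletion L) = 1 := by
    have h := (Valuation.integer.integers (valuation (w.1.adicCompletion L))).isUnit_iff_valuation_eq_one.mp h2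
    rw [map_ofNat] at h
    exact (v_eq_one_iff_valuation_eq_one _).2 h
  obtain ⟨ε, hε⟩ := FiniteField.exists_nonsquare (ringChar_residueField_ne_two L v w hw h2w)
  obtain ⟨c, c', c₁, -, hR1, hR2, hR3, hR4s, hR4n⟩ :=
    exists_twoLayerStrataValues_of_levelOne_ramified_of_not_isSquare L H' hH' w hw he hH'w hH'i h2 ϖ hϖ hσϖ A hA hframe g hginv hg1 hε
  refine ⟨c 2 * (1 - (Ideal.absNorm v.asIdeal : ℂ)⁻¹) +
    (Ideal.absNorm v.asIdeal : ℂ)⁻¹ * (c' 2 * (1 - (Ideal.absNorm v.asIdeal : ℂ)⁻¹) + 2⁻¹ * (c₁ 1 + c₁ ε) * ((Ideal.absNorm v.asIdeal : ℂ)⁻¹ * (1 - (Ideal.absNorm v.asIdeal : ℂ)⁻¹)) +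
      c' 0 * ((Ideal.absNorm v.asIdeal : ℂ) ^ 2)⁻¹), ?_⟩
  intro _ _ ψ hψK _ T hT hψT μN _
  exact integral_comp_symm_eq_of_levelOne_split_ramified L w hw H' hH' ψ hψK T hT hψT he hH'w hH'i hϖ hσϖ h2w μN g hgK hg1 (c 2) c' hR1 ⟨hR2, hR3⟩
    (c₁ 1) (c₁ ε) hR4s hR4n

end Literature.NumberTheory.Rogawski1990

end
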